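import Summits.AnomalousDissipation.AnomalousDissipation.Theorems.SolenoidalFractalHomogenisationRealisedQuasiStaticCellLawSlavedSectorSlot
import Summits.AnomalousDissipation.AnomalousDissipation.Theorems.SolenoidalFractalHomogenisationRealisedQuasiStaticCellLawPeriodicContraction
import Summits.AnomalousDissipation.AnomalousDissipation.Theorems.SolenoidalFractalHomogenisationRealisedQuasiStaticCellLawSectorExpDecay
import HarnessLib

/-!
# K2R `RealisedQuasiStaticCellLaw`, line `floquet-bloch`, stub `stub_lowSectorDecay` (S1D): exponential decay of the
# truncation energy of a WEAKLY coupled low sector, uniformly in `N` (all slots, per-period composition)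

Summits-side helper file (everything proved; no definitions, no named facts; `--supports stmt-AnomalousDissipation-20446`).
Weak-coupling counterpart of `sectorEnergy_exp_decay` (`…SectorExpDecay`). Hypotheses: for EVERY slot `j` of the word the
geometric data of `slavedSector_slot_contraction` (frame `ζ_j`, in-plane frame `p_{j,J}`, index segment `Wset_j ∋ 0, ±1`,
gap `Δ`, weights `β ≥ 1`, `ε`, second-order weights `σ^{out}_j`, `σ^{in}_j`, peak coupling `g_{1,j}`, weak-coupling
smallness) and a per-slot factor `Θ_j` dominating the three slot factors, with `0 < ∏_j Θ_j ≤ 1`. Then the weighted sector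
energy `Ψ_β` contracts by `Θ_j` over slot `j` of every period (`Ψ_β ≥ 0`), hence by `∏_j Θ_j` over every period (the slots
tile the period), and since `E_N ≤ Ψ_β ≤ β E_N` and `E_N` is non-increasing,
`E_N(t) ≤ β (∏Θ)⁻¹ exp(−(log (∏Θ)⁻¹/P) t) E_N(0)` for all `t ≥ 0` (`slavedSector_exp_decay`; `dominated_periodic_decay` is
the elementary real-analysis step). The overhead `β` is paid ONCE — this is the point of the weak-coupling regime
(cell `ad-ideate`, evidence #23 on 20446).
-/

set_option linter.dupNamespace false

noncomputable section

namespace Summit.AnomalousDissipation.AnomalousDissipation.Theorems.SolenoidalFractalHomogenisation.RealisedQuasiStaticCellLaw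

open Set MeasureTheory Filter Topology Function Complex Matrix
open scoped InnerProductSpace ComplexConjugate Matrix
open Literature.Analysis Literature.Analysis.FunctionSpaces Literature.Analysis.FunctionSpaces.Torus
open Literature.Analysis.FluidPDE Literature.Analysis.FluidPDE.LatticeShear
open Summit.AnomalousDissipation.AnomalousDissipation.Theorems.SolenoidalFractalHomogenisation.PermissibleCarrier

variable {k₀ : ℕ}

/-- **Exponential decay from a dominating functional with per-period contraction.** `E ≥ 0` non-increasing on `[0, ∞)`,
`E(pP) ≤ Ψ(pP)` at the period lattice, `Ψ(0) ≤ β E(0)`, `Ψ((p+1)P) ≤ θ Ψ(pP)` with `0 < θ ≤ 1`: then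
`E(t) ≤ β θ⁻¹ exp(−(log θ⁻¹/P) t) E(0)` for `t ≥ 0`. -/
theorem dominated_periodic_decay {E Ψ : ℝ → ℝ} {P θ β : ℝ} (hP : 0 < P) (hθ0 : 0 < θ) (hθ1 : θ ≤ 1) (hβ : 0 ≤ β)
    (hE0 : 0 ≤ E 0) (hmono : ∀ s t, 0 ≤ s → s ≤ t → E t ≤ E s)
    (hEΨ : ∀ p : ℕ, E (p * P) ≤ Ψ (p * P)) (hΨ0 : Ψ 0 ≤ β * E 0)
    (hcontr : ∀ p : ℕ, Ψ ((p + 1 : ℕ) * P) ≤ θ * Ψ (p * P)) {t : ℝ} (ht : 0 ≤ t) :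
    E t ≤ β * θ⁻¹ * Real.exp (-(Real.log θ⁻¹ / P) * t) * E 0 := by
  set p : ℕ := ⌊t / P⌋₊ with hp
  have hpt : (p : ℝ) * P ≤ t := by
    have h1 : (p : ℝ) ≤ t / P := Nat.floor_le (div_nonneg ht hP.le)
    calc (p : ℝ) * P ≤ t / P * P := mul_le_mul_of_nonneg_right h1 hP.le
      _ = t := div_mul_cancel₀ t hP.ne'
  have htp : t / P < p + 1 := Nat.lt_floor_add_one (t / P)
  have hΨp : Ψ (p * P) ≤ θ ^ p * Ψ 0 := periodic_contraction_pow hθ0.le hcontr p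
  have h0' : Ψ ((0 : ℕ) * P) = Ψ 0 := by simp
  have h1 : E t ≤ θ ^ p * (β * E 0) :=
    calc E t ≤ E (p * P) := hmono _ _ (by positivity) hpt
      _ ≤ Ψ (p * P) := hEΨ p
      _ ≤ θ ^ p * Ψ 0 := hΨp
      _ ≤ θ ^ p * (β * E 0) := mul_le_mul_of_nonneg_left hΨ0 (pow_nonneg hθ0.le _)
  have hlog : 0 ≤ Real.log θ⁻¹ := Real.log_nonneg (one_le_inv_iff₀.2 ⟨hθ0, hθ1⟩)
  have h2 : θ ^ p ≤ θ⁻¹ * Real.exp (-(Real.log θ⁻¹ / P) * t) := by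
    have e1 : θ ^ p = Real.exp (-(Real.log θ⁻¹) * p) := by
      rw [Real.log_inv, neg_neg, ← Real.exp_log (pow_pos hθ0 p), Real.log_pow]
      ring_nf
    have e2 : θ⁻¹ * Real.exp (-(Real.log θ⁻¹ / P) * t) = Real.exp (-(Real.log θ⁻¹) * (t / P - 1)) := by
      rw [show θ⁻¹ * Real.exp (-(Real.log θ⁻¹ / P) * t) =
          Real.exp (Real.log θ⁻¹) * Real.exp (-(Real.log θ⁻¹ / P) * t) by rw [Real.exp_log (inv_pos.2 hθ0)],
        ← Real.exp_add]
      congr 1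
      field_simp
      ring
    rw [e1, e2, Real.exp_le_exp]
    have h3 : t / P - 1 ≤ p := by linarith
    nlinarith
  calc E t ≤ θ ^ p * (β * E 0) := h1
    _ ≤ θ⁻¹ * Real.exp (-(Real.log θ⁻¹ / P) * t) * (β * E 0) := mul_le_mul_of_nonneg_right h2 (by positivity)
    _ = β * θ⁻¹ * Real.exp (-(Real.log θ⁻¹ / P) * t) * E 0 := by ring

/-- Slot starts as partial sums over `range`: `start j = Σ_{i < j.val} τ_i`. -/
theorem start_eq_sum_range (W : LatticeWord k₀) (m : ℕ) (hm : m < k₀) :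
    W.start ⟨m, hm⟩ = ∑ i ∈ Finset.range m, (if h : i < k₀ then (W.phase ⟨i, h⟩).τ else 0) := by
  classical
  unfold LatticeWord.start
  rw [Finset.sum_filter]
  have h1 : ∑ i : Fin k₀, (if i < (⟨m, hm⟩ : Fin k₀) then (W.phase i).τ else 0) =
      ∑ i : Fin k₀, (fun i' : ℕ => if i' < m then (if h : i' < k₀ then (W.phase ⟨i', h⟩).τ else 0) else 0) (i : ℕ) := by
    refine Finset.sum_congr rfl fun i _ => ?_
    have hi : (i : ℕ) < k₀ := i.isLt
    simp only [Fin.lt_def, hi, dif_pos]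
  rw [h1, Fin.sum_univ_eq_sum_range (fun i' : ℕ => if i' < m then (if h : i' < k₀ then (W.phase ⟨i', h⟩).τ else 0) else 0) k₀,
    ← Finset.sum_filter]
  congr 1
  ext i
  simp only [Finset.mem_filter, Finset.mem_range]
  omega

/-- The period as a sum over `range k₀`. -/
theorem period_eq_sum_range (W : LatticeWord k₀) :
    W.period = ∑ i ∈ Finset.range k₀, (if h : i < k₀ then (W.phase ⟨i, h⟩).τ else 0) := by
  unfold LatticeWord.period
  rw [← Fin.sum_univ_eq_sum_range (fun i' : ℕ => if h : i' < k₀ then (W.phase ⟨i', h⟩).τ else 0) k₀]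
  refine Finset.sum_congr rfl fun i _ => ?_
  simp [i.isLt]

set_option maxHeartbeats 400000 in
/-- **Exponential decay of the truncation energy of a weakly coupled low sector, uniformly in `N`.** For every slot `j`
the data of `slavedSector_slot_contraction` (as functions of `j`) and a dominating slot factor `Θ j`; `0 < ∏ Θ ≤ 1`. Then
`E_N(t) ≤ β (∏_j Θ_j)⁻¹ exp(−(log(∏_j Θ_j)⁻¹ / P) t) E_N(0)` for all `t ≥ 0`. -/
theorem slavedSector_exp_decay (W : LatticeWord k₀) {n : ℕ} (hn : 0 < n) {κ : ℝ} (hκ : 0 < κ)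
    (ℓ : Fin 3 → ℤ) (hℓn : 2 * ‖latticeVec ℓ‖ ≤ n) {w₀ : UnitAddTorus (Fin 3) → EuclideanSpace ℝ (Fin 3)}
    (hw₀ : FunctionSpaces.Torus.MemSobolev 1 (FunctionSpaces.EuclideanSpace.complexify ∘ w₀))
    (hdiv : FunctionSpaces.Torus.IsWeaklyDivFree w₀) (hmean : FunctionSpaces.Torus.HasZeroMean w₀)
    (hsupp : ∀ k : Fin 3 → ℤ, ¬ ((∃ z : Fin 3 → ℤ, k = ℓ + (n:ℤ) • z) ∨ (∃ z : Fin 3 → ℤ, k = -ℓ + (n:ℤ) • z)) →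
      UnitAddTorus.mFourierCoeff (FunctionSpaces.EuclideanSpace.complexify ∘ w₀) k = 0)
    {N : ℕ} (hBN : (Finset.univ.biUnion fun j : Fin k₀ =>
        ({(fun i => (W.phase j).m i * n), -(fun i => (W.phase j).m i * n)} : Finset (Fin 3 → ℤ))) ⊆ freqBall N)
    (hk : ∀ j : Fin k₀, ∀ J : ℤ, ℓ + J • (fun i => (W.phase j).m i * (n : ℤ)) ∈ freqBall N →
      ℓ + J • (fun i => (W.phase j).m i * (n : ℤ)) ≠ 0)
    (hdisj : ∀ j : Fin k₀, ∀ J J' : ℤ,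
      ℓ + J • (fun i => (W.phase j).m i * (n : ℤ)) ≠ -(ℓ + J' • (fun i => (W.phase j).m i * (n : ℤ))))
    (ζr : Fin k₀ → Fin 3 → ℝ) (hζ1 : ∀ j, ζr j ⬝ᵥ ζr j = 1) (hζ0 : ∀ j, ζr j ⬝ᵥ (fun i => ((ℓ i : ℤ) : ℝ)) = 0)
    (hζK : ∀ j, ζr j ⬝ᵥ (fun i => (((fun i => (W.phase j).m i * (n : ℤ)) i : ℤ) : ℝ)) = 0)
    (pf : Fin k₀ → ℤ → Fin 3 → ℝ)
    (hp : ∀ j, ∀ J : ℤ, pf j J = (Real.sqrt ((fun i => (((ℓ + J • (fun i => (W.phase j).m i * (n : ℤ))) i : ℤ) : ℝ)) ⬝ᵥ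
        (fun i => (((ℓ + J • (fun i => (W.phase j).m i * (n : ℤ))) i : ℤ) : ℝ))))⁻¹ •
        (fun i => (((ℓ + J • (fun i => (W.phase j).m i * (n : ℤ))) i : ℤ) : ℝ)) ⨯₃ ζr j)
    (Wset : Fin k₀ → Finset ℤ)
    (hW : ∀ j, ∀ J : ℤ, J ∈ Wset j ↔ ℓ + J • (fun i => (W.phase j).m i * (n : ℤ)) ∈ freqBall N)
    (h0 : ∀ j, (0 : ℤ) ∈ Wset j) (h1 : ∀ j, (1 : ℤ) ∈ Wset j) (hm1 : ∀ j, (-1 : ℤ) ∈ Wset j)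
    (hs : ∀ j, ∀ J ∈ Wset j, |pf j J ⬝ᵥ pf j (J + 1)| ≤ 1)
    (Λ σo σi g₁ Θ : Fin k₀ → ℝ) (Δ ε β : ℝ)
    (hΛ : ∀ j, Λ j = κ * (4 * Real.pi ^ 2 * freqNormSq (fun i => (W.phase j).m i * (n : ℤ))))
    (hΔ0 : 0 < Δ) (hε : 0 ≤ ε) (hβ : 1 ≤ β)
    (hgap : ∀ j, ∀ J ∈ Wset j, J ≠ 0 →
      freqNormSq ℓ / freqNormSq (fun i => (W.phase j).m i * (n : ℤ)) + Δ ≤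
        freqNormSq (ℓ + J • (fun i => (W.phase j).m i * (n : ℤ))) / freqNormSq (fun i => (W.phase j).m i * (n : ℤ)))
    (hσo : ∀ j, σo j = 1 / (freqNormSq (ℓ + (-1 : ℤ) • (fun i => (W.phase j).m i * (n : ℤ))) /
          freqNormSq (fun i => (W.phase j).m i * (n : ℤ)) - freqNormSq ℓ / freqNormSq (fun i => (W.phase j).m i * (n : ℤ))) +
        1 / (freqNormSq (ℓ + (1 : ℤ) • (fun i => (W.phase j).m i * (n : ℤ))) /
          freqNormSq (fun i => (W.phase j).m i * (n : ℤ)) - freqNormSq ℓ / freqNormSq (fun i => (W.phase j).m i * (n : ℤ))))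
    (hσi : ∀ j, σi j = (pf j (-1) ⬝ᵥ pf j 0) ^ 2 / (freqNormSq (ℓ + (-1 : ℤ) • (fun i => (W.phase j).m i * (n : ℤ))) /
          freqNormSq (fun i => (W.phase j).m i * (n : ℤ)) - freqNormSq ℓ / freqNormSq (fun i => (W.phase j).m i * (n : ℤ))) +
        (pf j 0 ⬝ᵥ pf j 1) ^ 2 / (freqNormSq (ℓ + (1 : ℤ) • (fun i => (W.phase j).m i * (n : ℤ))) /
          freqNormSq (fun i => (W.phase j).m i * (n : ℤ)) - freqNormSq ℓ / freqNormSq (fun i => (W.phase j).m i * (n : ℤ))))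
    (hg₁ : ∀ j, g₁ j = 2 * Real.pi * (∑ i, (W.phase j).e i * (ℓ i : ℝ)) *
        ‖Complex.exp ((W.phase j).φ * Complex.I) *
          (1 / (2 * ((2 * Real.pi * ‖latticeVec (W.phase j).m‖ : ℝ) : ℂ) * Complex.I))‖ * (1 / (n : ℝ)) / Λ j)
    (hβo : ∀ j, 2 ≤ β * Δ * ε * σo j) (hsmallo : ∀ j, g₁ j ^ 2 * (4 * 2 / Δ + 2 * σo j) ≤ Δ)
    (hβi : ∀ j, (pf j 0 ⬝ᵥ pf j 1) ^ 2 + (pf j (-1) ⬝ᵥ pf j 0) ^ 2 ≤ β * Δ * ε * σi j)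
    (hsmalli : ∀ j, g₁ j ^ 2 * (4 * ((pf j 0 ⬝ᵥ pf j 1) ^ 2 + (pf j (-1) ⬝ᵥ pf j 0) ^ 2) / Δ + 2 * σi j) ≤ Δ)
    (hΘ : ∀ j, max (Real.exp (-(8 * Real.pi ^ 2 * κ * ((n : ℝ) / 2) ^ 2) * (W.phase j).τ))
        (max (Real.exp (-(2 * Λ j * (W.phase j).τ * (freqNormSq ℓ / freqNormSq (fun i => (W.phase j).m i * (n : ℤ)) +
              (1 - ε) * σo j * (g₁ j ^ 2 * (1 - 4 * W.ramp / 3)))) +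
            40 * β * 2 * Λ j * (W.phase j).τ * g₁ j ^ 4 * (1 + g₁ j ^ 2 * σo j ^ 2) / Δ ^ 3 +
            48 * β * 2 * g₁ j ^ 2 / (W.ramp * (W.phase j).τ * Λ j * Δ ^ 3)))
          (Real.exp (-(2 * Λ j * (W.phase j).τ * (freqNormSq ℓ / freqNormSq (fun i => (W.phase j).m i * (n : ℤ)) +
              (1 - ε) * σi j * (g₁ j ^ 2 * (1 - 4 * W.ramp / 3)))) +
            40 * β * ((pf j 0 ⬝ᵥ pf j 1) ^ 2 + (pf j (-1) ⬝ᵥ pf j 0) ^ 2) * Λ j * (W.phase j).τ * g₁ j ^ 4 *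
              (1 + g₁ j ^ 2 * σi j ^ 2) / Δ ^ 3 +
            48 * β * ((pf j 0 ⬝ᵥ pf j 1) ^ 2 + (pf j (-1) ⬝ᵥ pf j 0) ^ 2) * g₁ j ^ 2 /
              (W.ramp * (W.phase j).τ * Λ j * Δ ^ 3)))) ≤ Θ j)
    (hΘ1 : ∏ j, Θ j ≤ 1) (hΘ0 : 0 < ∏ j, Θ j) {t : ℝ} (ht : 0 ≤ t) :
    ∑ k ∈ freqBall N, ‖(pvSetup_cell W hn hκ.le ℓ hw₀ hdiv hmean hsupp).galerkinCoeffAt N t k‖ ^ 2 ≤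
      β * (∏ j, Θ j)⁻¹ * Real.exp (-(Real.log (∏ j, Θ j)⁻¹ / W.period) * t) *
        ∑ k ∈ freqBall N, ‖(pvSetup_cell W hn hκ.le ℓ hw₀ hdiv hmean hsupp).galerkinCoeffAt N 0 k‖ ^ 2 := by
  classical
  set hPV := pvSetup_cell W hn hκ.le ℓ hw₀ hdiv hmean hsupp with hPVdef
  have hP := period_pos W
  have hβ0 : 0 ≤ β := zero_le_one.trans hβ
  obtain ⟨E, hE⟩ : ∃ E : ℝ → ℝ, E = fun τ => ∑ k ∈ freqBall N, ‖hPV.galerkinCoeffAt N τ k‖ ^ 2 := ⟨_, rfl⟩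
  obtain ⟨Ψ, hΨ⟩ : ∃ Ψ : ℝ → ℝ, Ψ = fun τ => β * ∑ k ∈ freqBall N, ‖hPV.galerkinCoeffAt N τ k‖ ^ 2 -
      (β - 1) * (‖hPV.galerkinCoeffAt N τ ℓ‖ ^ 2 + ‖hPV.galerkinCoeffAt N τ (-ℓ)‖ ^ 2) := ⟨_, rfl⟩
  have hEnn : ∀ τ, 0 ≤ E τ := fun τ => by rw [hE]; exact Finset.sum_nonneg fun k _ => by positivity
  -- `E ≤ Ψ ≤ βE`: the slow pair `±ℓ` lies in the ball and is distinct
  have j0 : Fin k₀ := ⟨0, W.pos⟩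
  have hℓS : ℓ ∈ freqBall N := by
    have := (hW j0 0).1 (h0 j0); simpa using this
  have hℓS' : -ℓ ∈ freqBall N := neg_mem_freqBall_of_mem _ hℓS
  have hℓne : ℓ ≠ -ℓ := by
    have := hdisj j0 0 0; simpa using this
  have hpair : ∀ τ, ‖hPV.galerkinCoeffAt N τ ℓ‖ ^ 2 + ‖hPV.galerkinCoeffAt N τ (-ℓ)‖ ^ 2 ≤ E τ := by
    intro τ
    rw [hE]
    have hsub : ({ℓ, -ℓ} : Finset (Fin 3 → ℤ)) ⊆ freqBall N := by
      intro k hk'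
      simp only [Finset.mem_insert, Finset.mem_singleton] at hk'
      rcases hk' with rfl | rfl
      · exact hℓS
      · exact hℓS'
    have := Finset.sum_le_sum_of_subset_of_nonneg hsub (fun k _ _ => sq_nonneg ‖hPV.galerkinCoeffAt N τ k‖)
    rw [Finset.sum_pair hℓne] at this
    exact this
  have hEΨ : ∀ τ, E τ ≤ Ψ τ := by
    intro τ
    have h := hpair τ
    rw [hΨ]; rw [hE] at h ⊢
    nlinarith [h, hβ]
  have hΨnn : ∀ τ, 0 ≤ Ψ τ := fun τ => (hEnn τ).trans (hEΨ τ)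
  have hΨ0 : Ψ 0 ≤ β * E 0 := by
    rw [hΨ, hE]
    have : 0 ≤ ‖hPV.galerkinCoeffAt N 0 ℓ‖ ^ 2 + ‖hPV.galerkinCoeffAt N 0 (-ℓ)‖ ^ 2 := by positivity
    nlinarith [this, hβ]
  -- one slot of one period
  have hslot : ∀ q : ℕ, ∀ j : Fin k₀,
      Ψ ((q : ℝ) * W.period + W.start j + (W.phase j).τ) ≤ Θ j * Ψ ((q : ℝ) * W.period + W.start j) := by
    intro q j
    have h := slavedSector_slot_contraction W hn hκ ℓ hℓn hw₀ hdiv hmean hsupp hBN q j le_rfl (hk j) (hdisj j) (hζ1 j)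
      (hζ0 j) (hζK j) (hp j) (hW j) (h0 j) (h1 j) (hm1 j) (hs j) (Λ j) Δ ε β (σo j) (σi j) (g₁ j) (hΛ j) hΔ0 hε hβ
      (hgap j) (hσo j) (hσi j) (hg₁ j) (hβo j) (hsmallo j) (hβi j) (hsmalli j) (Θ j) (hΘ j)
    rw [hΨ]
    exact h
  -- chaining the slots of one period
  have hΘnn : ∀ j, 0 ≤ Θ j := fun j => le_trans (le_trans (Real.exp_pos _).le (le_max_left _ _)) (hΘ j)
  have hchain : ∀ q : ℕ, ∀ m : ℕ, m ≤ k₀ →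
      Ψ ((q : ℝ) * W.period + ∑ i ∈ Finset.range m, (if h : i < k₀ then (W.phase ⟨i, h⟩).τ else 0)) ≤
        (∏ i ∈ Finset.range m, (if h : i < k₀ then Θ ⟨i, h⟩ else 1)) * Ψ ((q : ℝ) * W.period) := by
    intro q m
    induction m with
    | zero => intro _; simp
    | succ m ih =>
      intro hm
      have hm' : m < k₀ := Nat.lt_of_succ_le hm
      have ih' := ih hm'.le
      rw [Finset.sum_range_succ, Finset.prod_range_succ, dif_pos hm', dif_pos hm', ← start_eq_sum_range W m hm',
        ← add_assoc]
      rw [← start_eq_sum_range W m hm'] at ih'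
      calc Ψ ((q : ℝ) * W.period + W.start ⟨m, hm'⟩ + (W.phase ⟨m, hm'⟩).τ)
          ≤ Θ ⟨m, hm'⟩ * Ψ ((q : ℝ) * W.period + W.start ⟨m, hm'⟩) := hslot q ⟨m, hm'⟩
        _ ≤ Θ ⟨m, hm'⟩ * ((∏ i ∈ Finset.range m, (if h : i < k₀ then Θ ⟨i, h⟩ else 1)) * Ψ ((q : ℝ) * W.period)) :=
            mul_le_mul_of_nonneg_left ih' (hΘnn _)
        _ = (∏ i ∈ Finset.range m, (if h : i < k₀ then Θ ⟨i, h⟩ else 1)) * Θ ⟨m, hm'⟩ * Ψ ((q : ℝ) * W.period) := by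
            ring
  have hprod : ∏ i ∈ Finset.range k₀, (if h : i < k₀ then Θ ⟨i, h⟩ else 1) = ∏ j, Θ j := by
    rw [← Fin.prod_univ_eq_prod_range (fun i' : ℕ => if h : i' < k₀ then Θ ⟨i', h⟩ else 1) k₀]
    refine Finset.prod_congr rfl fun i _ => ?_
    simp [i.isLt]
  have hcontr : ∀ q : ℕ, Ψ (((q + 1 : ℕ) : ℝ) * W.period) ≤ (∏ j, Θ j) * Ψ ((q : ℝ) * W.period) := by
    intro q
    have h := hchain q k₀ le_rfl
    rw [← period_eq_sum_range W, hprod] at h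
    have e : (((q + 1 : ℕ) : ℝ)) * W.period = (q : ℝ) * W.period + W.period := by push_cast; ring
    rw [e]
    exact h
  -- the energy is non-increasing
  have hmono : ∀ s τ, 0 ≤ s → s ≤ τ → E τ ≤ E s := fun s τ hs0 hsτ => by
    rw [hE]; exact totalEnergy_antitone W hn hκ.le ℓ hw₀ hdiv hmean hsupp N hs0 hsτ
  have hmain := dominated_periodic_decay (E := E) (Ψ := Ψ) hP hΘ0 hΘ1 hβ0 (hEnn 0) hmono (fun q => hEΨ _) hΨ0 hcontr ht
  rw [hE] at hmain
  exact hmain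

end Summit.AnomalousDissipation.AnomalousDissipation.Theorems.SolenoidalFractalHomogenisation.RealisedQuasiStaticCellLaw

end
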